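import Literature.AlgebraicGeometry.HodgeTheory.CMHodgeGroupPowersHodgeClasses
import Literature.AlgebraicGeometry.HodgeTheory.QuarticCMTwoOnePowersHodgeClasses
import HarnessLib

/-!
# `Hg = U_E` for a QUARTIC CM field `E = End⁰(A)`, any multiplicities ⟹ the Hodge classes on all powers of `A` are generated by divisor classes (Moonen–Zarhin 1999 (1.8) for `D = E` quartic CM, Hazama / Murty; the Lie step as a hypothesis)

Family `hodge`, layer `Literature/AlgebraicGeometry/HodgeTheory`. Research context: cell `pub-hodgeav-hg6` (LADDER-HodgeAV
PERC-SHAPE row 2, «base of HC ladder», req-37 Q2b TABLE X row 10; HONEST FRAMING: nothing here proves HC, HC_AV or HC_CM;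
not a corollary). UNCONDITIONAL for the class of abelian varieties it names; theorems only, no definition, no named fact
(D-0026), no `sorry`. The geometric end of the coloured socket `CMHodgeGroupSlotsHodgeClasses` / `CMHodgeGroupDualBases` /
`CMHodgeGroupPowersHodgeClasses` at `ι = Fin 2` (two pairs of conjugate places = a quartic CM field).

THE PRINT. Moonen–Zarhin 1999 (1.8) [corpus: paper:arxiv-math_9901113 p0004 L72–88]: «Hazama and Murty (independently):
`Hg(X) = Sp_D(V,φ)` ⟺ (no factors of type III and `D(Xⁿ) = B(Xⁿ)` for all `n`)», `Sp_D(V,φ)` the centralizer of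
`D = End⁰(X)` in `Sp(V,φ)`; for `D = E` a CM field `Sp_E(V,φ) = U_E(V,ψ)` ((2.3) «`Hg(X) = U_F(V,ψ)`»). MZ99 Table 1 /
(2.4): in dimension `4` and `End⁰ = E` quartic CM of signature `{(1,1),(2,0)}` this holds for EVERY simple member — the
tree's UNCONDITIONAL `AbelianVariety.isDivisorGenerated_of_quarticCM` (`QuarticCMTwoOnePowersHodgeClasses`, its Lie step
proved); in dimension `6` (`dim_E H¹ = 3`, TABLE X row 10) it is the GENERAL member only, and the Lie step is carried here
as the HYPOTHESIS `hU`: every `(φ^*)_ℂ`-commuting `ψ_ℂ`-skew operator of `H¹(A(ℂ); ℂ)` lies in `Lie Hg(H¹(A)) ⊗ ℂ`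
(`Lie Hg ⊗ ℂ = 𝔲_E ⊗ ℂ ≅ 𝔤𝔩(W_{μ₁}) × 𝔤𝔩(W_{μ₂})`).

MAIN RESULTS. **`AVSlots.isDivisorGenerated_of_hodgeLieC_quarticCM`**: `A` a complex abelian variety with
`finrank_ℚ End⁰(A) = 4`, `φ ∈ End(A)` whose eigenvalues `μ₁, conj μ₁, μ₂, conj μ₂` on `H¹` are pairwise distinct with
`eigenMultiplicity A φ μ_k + eigenMultiplicity A φ (conj μ_k) = n₀` (`k = 1, 2`), `0 < n₀`, `dim A = 2 n₀` (so
`E = End⁰(A) = ℚ(φ)` is a quartic CM field and `dim_E H¹ = n₀`; NO simplicity hypothesis), a polarization `ψ` of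
`H¹(A(ℂ); ℚ)` and `hU` ⟹ `B•(B) = D•(B) ⊗ ℂ` for every `B` with slots over `A`;
`AbelianVariety.isDivisorGenerated_powSucc_of_hodgeLieC_quarticCM`, `AbelianVariety.isDivisorGenerated_of_hodgeLieC_quarticCM`,
`hodgeConjectureFor_powSucc_of_hodgeLieC_quarticCM`, `hodgeConjectureFor_of_isIsogenous_powSucc_of_hodgeLieC_quarticCM`.
Assembly: `End_Hdg(H¹) = ℚ[φ^*_ℚ]` (`exists_eq_sum_smul_pow_bettiMapHom`), the multiplicity count
(`finrank_eigenspace_inf_piece_…_eq_eigenMultiplicity…`, `CMTheta.finrank_eigenspace_eq_add`, independence of eigenspaces),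
`CMTheta.exists_adaptedDualBasis`, `AVSlots.isDivisorGenerated_of_cmData_of_hodgeLieC`, and the crossed classes of each
colour by the tree's `sum_cupH1_colour_mem_span_rational_oneOne` (ψ-Casimir classes of `1, φ, φ²`).

## References

* [MoonenZarhin1999LowDim] B. Moonen, Yu. Zarhin, Math. Ann. 315 (1999) = arXiv:math/9901113, §1 (1.8), §2 (2.3)–(2.4), Thm. (0.2)(4).
* [Hazama1983] F. Hazama, Tôhoku Math. J. 35 (1983), Thm. (1.1), §3 pp. 305–306.
* [Murty1984] V. K. Murty, Math. Ann. 268 (1984), Thm. 3.1, §3.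
* [Milne1999LefschetzClasses] J. S. Milne, Duke Math. J. 96 (1999), Prop. 3.3, Prop. 3.6 (c).
* [Deligne1982HodgeCycles] P. Deligne, LNM 900 (1982), §4 (p. 30).
* [vanGeemen1994HodgeAV] B. van Geemen, LNM 1594 (1994), §2.4, Lemma 3.7.
* [MumfordAV1970] D. Mumford, *Abelian Varieties* (1970), §1 (p. 4), §19 Cor. 2 of Thm. 1.
-/

noncomputable section

open scoped TensorProduct Matrix
open CategoryTheory Module

namespace Literature.AlgebraicGeometry.HodgeTheory

open Literature.AlgebraicTopology.SingularHomology
open Literature.AlgebraicGeometry.Motives (IsSmoothProjective AbelianVariety bettiCohomology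
  ofRatClassBaseChange ofRatClassBaseChange_tmul HodgeTensorFacts hodgeTensorFacts_holds)
open Literature.Barriers.HodgeConjecture
open Literature.AlgebraicGeometry.Motives.HodgeStructure
open Literature.RepresentationTheory.GeneralLinear
open Literature.NumberTheory.DiophantineGeometry
open Literature.AlgebraicGeometry.ComplexMultiplication (bettiRep bettiRep_of)

section Assembly

variable {A B : AbelianVariety ℂ} {n : ℕ} {g : Fin n → (B ⟶ A)}

/-- **`B•(B) = D•(B) ⊗ ℂ` for every abelian variety `B` with slots over `A` with `End⁰(A) = E` a QUARTIC CM field and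
`Hg(A) = U_E(H¹(A;ℚ), ψ)` (Lie form `hU`), ANY multiplicities** — MZ99 (1.8) ⟹ for `D = E` (Hazama, Murty). Hypotheses:
`finrank_ℚ End⁰(A) = 4`; `φ ∈ End(A)` with eigenvalues `μ₁, conj μ₁, μ₂, conj μ₂` pairwise distinct and
`eigenMultiplicity A φ μ_k + eigenMultiplicity A φ (conj μ_k) = n₀` for `k = 1, 2`; `0 < n₀`; `dim A = 2 n₀`; a polarization
`ψ` of `H¹(A(ℂ); ℚ)` (Betti universe) with `hU`. Then `End_Hdg(H¹) = ℚ[φ^*_ℚ]` (`exists_eq_sum_smul_pow_bettiMapHom`: the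
four eigenspaces are non-zero since each has dimension `n₀`), the four eigenspaces have dimension `n₀` each
(`CMTheta.finrank_eigenspace_eq_add` + the multiplicity dictionary) and fill `H¹ ⊗ ℂ` (independence of eigenspaces, `4 n₀ =
2 dim A`), so `CMTheta.exists_adaptedDualBasis` applies, and `AVSlots.isDivisorGenerated_of_cmData_of_hodgeLieC` with the
crossed classes of each colour divisorial (`sum_cupH1_colour_mem_span_rational_oneOne`,
`Milne1999.sum_cross_mem_span_rational_oneOne_of_eigen`) concludes. No simplicity hypothesis is used.
[cite: MoonenZarhin1999LowDim, §1 (1.8), §2 (2.3)–(2.4)] [cite: Deligne1982HodgeCycles, §4 (p. 30)]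
[cite: Milne1999LefschetzClasses, Prop. 3.3 and Prop. 3.6 (c)] [cite: MumfordAV1970, §1 (p. 4)] -/
theorem AVSlots.isDivisorGenerated_of_hodgeLieC_quarticCM [HodgeTensorFacts.{0, 0}] (hg : AVSlots A B g) (φ : A ⟶ A)
    (hE4 : Module.finrank ℚ A.endAlgebra = 4) {μ₁ μ₂ : ℂ} (h11 : starRingEnd ℂ μ₁ ≠ μ₁)
    (h22 : starRingEnd ℂ μ₂ ≠ μ₂) (h12 : μ₂ ≠ μ₁) (h12' : μ₂ ≠ starRingEnd ℂ μ₁) {n₀ : ℕ} (hn₀ : 0 < n₀)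
    (h1 : eigenMultiplicity A φ μ₁ + eigenMultiplicity A φ (starRingEnd ℂ μ₁) = n₀)
    (h2 : eigenMultiplicity A φ μ₂ + eigenMultiplicity A φ (starRingEnd ℂ μ₂) = n₀) (hdim : A.dim = 2 * n₀)
    (hHD : exists_isReal_hodgeModel) (hI : hodgePQ_independent_of_hodgeModel)
    (ψ : (BettiUniverse.hodge hHD (AbelianVariety.isSmoothProjective_holds (A := A)) 1).Polarization)
    (hU : ∀ Y : Module.End ℂ (ℂ ⊗[ℚ] bettiCohomology A.X 1),
      Y * ((bettiCohomology.map φ.hom.hom.hom 1).hom).baseChange ℂ =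
          ((bettiCohomology.map φ.hom.hom.hom 1).hom).baseChange ℂ * Y →
        (∀ x y, ψ.form.baseChange ℂ (Y x) y + ψ.form.baseChange ℂ x (Y y) = 0) →
          Y ∈ (BettiUniverse.hodge hHD (AbelianVariety.isSmoothProjective_holds (A := A)) 1).hodgeLieC) :
    IsDivisorGenerated B := by
  classical
  haveI : Module.Finite ℚ (bettiCohomology A.X 1) := finite_bettiCohomology_one A
  have hX : IsSmoothProjective A.dim A.X := AbelianVariety.isSmoothProjective_holds
  have heff := BettiUniverse.hodge_isEffective hHD hX 1
  -- the rational datum `φ^*_ℚ`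
  set φQ : Module.End ℚ (bettiCohomology A.X 1) := (bettiCohomology.map φ.hom.hom.hom 1).hom with hφQ
  have hφE : φQ ∈ (BettiUniverse.hodge hHD (AbelianVariety.isSmoothProjective_holds (A := A)) 1).endAlg := by
    have h := unop_bettiRep_mem_endAlg hHD hI (AbelianVariety.endAlgebra.of A φ)
    rwa [bettiRep_of, MulOpposite.unop_op] at h
  have hVC : Module.finrank ℂ (ℂ ⊗[ℚ] bettiCohomology A.X 1) = 4 * n₀ := by
    rw [Module.finrank_baseChange, finrank_bettiCohomology_one A, hdim]; ring
  -- the four eigenvalues and the dimensions of their eigenspaces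
  have h21 : starRingEnd ℂ μ₂ ≠ μ₁ := fun h => h12' (by rw [← h, starRingEnd_self_apply])
  set c : Fin 4 → ℂ := ![μ₁, starRingEnd ℂ μ₁, μ₂, starRingEnd ℂ μ₂] with hc
  have hcinj : Function.Injective c := by
    intro i j hij
    fin_cases i <;> fin_cases j
    all_goals simp [hc] at hij
    all_goals first
      | rfl
      | exact absurd hij h11.symm | exact absurd hij h11 | exact absurd hij h12.symm | exact absurd hij h12
      | exact absurd hij h21.symm | exact absurd hij h21
      | exact absurd hij (fun h => h12' (by rw [← h, starRingEnd_self_apply]))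
      | exact absurd hij (fun h => h12' (by rw [h, starRingEnd_self_apply]))
      | exact absurd hij (fun h => h12 (RingHom.injective _ h))
      | exact absurd hij (fun h => h12 (RingHom.injective _ h).symm)
      | exact absurd hij h12' | exact absurd hij h12'.symm
      | exact absurd hij h22 | exact absurd hij h22.symm
  have hgr := fun cc => CMTheta.finrank_eigenspace_eq_add
    (BettiUniverse.hodge hHD (AbelianVariety.isSmoothProjective_holds (A := A)) 1) Nat.cast_one heff hφE cc
  have h10 : ∀ cc, Module.finrank ℂ ↥(Module.End.eigenspace (φQ.baseChange ℂ) cc ⊓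
      (BettiUniverse.hodge hHD (AbelianVariety.isSmoothProjective_holds (A := A)) 1).piece 1 0) =
        eigenMultiplicity A φ cc := fun cc => by
    rw [hφQ, finrank_eigenspace_inf_piece_oneZero_eq_eigenMultiplicity hHD hI φ cc]
  have h01 : ∀ cc, Module.finrank ℂ ↥(Module.End.eigenspace (φQ.baseChange ℂ) cc ⊓
      (BettiUniverse.hodge hHD (AbelianVariety.isSmoothProjective_holds (A := A)) 1).piece 0 1) =
        eigenMultiplicity A φ (starRingEnd ℂ cc) := fun cc => by
    rw [hφQ, finrank_eigenspace_inf_piece_zeroOne_eq_eigenMultiplicity_conj hHD hI φ cc]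
  have hfin : ∀ j, Module.finrank ℂ ↥(Module.End.eigenspace (φQ.baseChange ℂ) (c j)) = n₀ := by
    intro j
    rw [hgr, h10, h01]
    fin_cases j
    · exact h1
    · show eigenMultiplicity A φ (starRingEnd ℂ μ₁) + eigenMultiplicity A φ (starRingEnd ℂ (starRingEnd ℂ μ₁)) = n₀
      rw [starRingEnd_self_apply, add_comm]; exact h1
    · exact h2
    · show eigenMultiplicity A φ (starRingEnd ℂ μ₂) + eigenMultiplicity A φ (starRingEnd ℂ (starRingEnd ℂ μ₂)) = n₀
      rw [starRingEnd_self_apply, add_comm]; exact h2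
  have hW : ∀ j, Module.End.eigenspace (φQ.baseChange ℂ) (c j) ≠ ⊥ := by
    intro j hj
    have h := hfin j
    rw [hj, finrank_bot] at h
    omega
  -- `End_Hdg = ℚ[φQ]`
  have hE := exists_eq_sum_smul_pow_bettiMapHom hHD hI φ hE4 c hcinj hW
  -- colours
  set μ : Fin 2 → ℂ := ![μ₁, μ₂] with hμ
  have hμ0 : μ 0 = μ₁ := rfl
  have hμ1 : μ 1 = μ₂ := rfl
  have hinj : Function.Injective μ := by
    intro i j hij
    fin_cases i <;> fin_cases j
    all_goals simp [hμ] at hij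
    all_goals first | rfl | exact absurd hij h12.symm | exact absurd hij h12
  have hdist : ∀ k k', μ k' ≠ starRingEnd ℂ (μ k) := by
    intro k k'
    fin_cases k <;> fin_cases k'
    · exact fun h => h11 (by simpa [hμ] using h.symm)
    · simpa [hμ] using h12'
    · intro h
      exact h12' (by simpa [hμ, starRingEnd_self_apply] using (congrArg (starRingEnd ℂ) h).symm)
    · exact fun h => h22 (by simpa [hμ] using h.symm)
  have hrank : ∀ k, Module.finrank ℂ ↥(Module.End.eigenspace (φQ.baseChange ℂ) (μ k) ⊓
      (BettiUniverse.hodge hHD (AbelianVariety.isSmoothProjective_holds (A := A)) 1).piece 1 0) +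
      Module.finrank ℂ ↥(Module.End.eigenspace (φQ.baseChange ℂ) (μ k) ⊓
      (BettiUniverse.hodge hHD (AbelianVariety.isSmoothProjective_holds (A := A)) 1).piece 0 1) = n₀ := by
    intro k
    rw [h10, h01]
    fin_cases k
    · exact h1
    · exact h2
  -- the four eigenspaces fill `H¹ ⊗ ℂ`
  have htop4 : (⨆ j, Module.End.eigenspace (φQ.baseChange ℂ) (c j)) = ⊤ := by
    have hind : iSupIndep fun j => Module.End.eigenspace (φQ.baseChange ℂ) (c j) :=
      (Module.End.eigenspaces_iSupIndep (φQ.baseChange ℂ)).comp hcinj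
    apply Submodule.eq_top_of_finrank_eq
    have h := Motives.finrank_biSup_eq_sum_of_iSupIndep hind Finset.univ
    have hs : (⨆ j ∈ (Finset.univ : Finset (Fin 4)), Module.End.eigenspace (φQ.baseChange ℂ) (c j)) =
        ⨆ j, Module.End.eigenspace (φQ.baseChange ℂ) (c j) := by simp
    rw [hs] at h
    rw [h, hVC, Finset.sum_congr rfl fun j _ => hfin j, Finset.sum_const, Finset.card_univ, Fintype.card_fin,
      smul_eq_mul]
  have htop : (⨆ kt : Fin 2 × Fin 2, Module.End.eigenspace (φQ.baseChange ℂ)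
      (if kt.2 = 0 then μ kt.1 else starRingEnd ℂ (μ kt.1))) = ⊤ := by
    rw [eq_top_iff, ← htop4]
    refine iSup_le fun j => ?_
    fin_cases j
    · exact le_iSup_of_le ((0 : Fin 2), (0 : Fin 2)) (by simp [hc, hμ])
    · exact le_iSup_of_le ((0 : Fin 2), (1 : Fin 2)) (by simp [hc, hμ])
    · exact le_iSup_of_le ((1 : Fin 2), (0 : Fin 2)) (by simp [hc, hμ])
    · exact le_iSup_of_le ((1 : Fin 2), (1 : Fin 2)) (by simp [hc, hμ])
  -- adapted dual bases
  obtain ⟨cb, κ, hcbW, hcbW', hcb0, hcb1, hdual, hiso⟩ := CMTheta.exists_adaptedDualBasis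
    (BettiUniverse.hodge hHD (AbelianVariety.isSmoothProjective_holds (A := A)) 1) Nat.cast_one heff ψ hφE hE μ
    hinj hdist hrank htop
  refine hg.isDivisorGenerated_of_cmData_of_hodgeLieC hHD hI ψ hU μ cb κ hcbW hcbW' hcb0 hcb1 hdual hiso
    fun j j' k => ?_
  -- the crossed classes of each colour are divisor classes
  have h12μ : μ 1 ≠ μ 0 := by rw [hμ0, hμ1]; exact h12
  have h12μ' : μ 1 ≠ starRingEnd ℂ (μ 0) := by rw [hμ0, hμ1]; exact h12'
  have hθ := sum_cupH1_colour_mem_span_rational_oneOne hHD hI ψ φQ μ h12μ h12μ' cb κ hcbW hcbW' hcb0 hcb1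
    hdual hiso k
  simp only [cupH1_apply] at hθ
  have hneμ : μ k ≠ starRingEnd ℂ (μ k) := (hdist k k)
  have he : ∀ i, VanGeemen1994.pullbackOne A φ (ofRatClassBaseChange (Motives.ComplexPoints A.X) 1
      (cb ((k, 0), i))) = μ k • ofRatClassBaseChange (Motives.ComplexPoints A.X) 1 (cb ((k, 0), i)) := fun i => by
    have h := congrArg (ofRatClassBaseChange (Motives.ComplexPoints A.X) 1)
      (Module.End.mem_eigenspace_iff.1 (hcbW k i))
    rw [hφQ, ofRatClassBaseChange_baseChange_bettiMapHom, map_smul] at h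
    exact h
  have hf : ∀ i, VanGeemen1994.pullbackOne A φ (ofRatClassBaseChange (Motives.ComplexPoints A.X) 1
      (cb ((k, 1), i))) = starRingEnd ℂ (μ k) • ofRatClassBaseChange (Motives.ComplexPoints A.X) 1
        (cb ((k, 1), i)) := fun i => by
    have h := congrArg (ofRatClassBaseChange (Motives.ComplexPoints A.X) 1)
      (Module.End.mem_eigenspace_iff.1 (hcbW' k i))
    rw [hφQ, ofRatClassBaseChange_baseChange_bettiMapHom, map_smul] at h
    exact h
  exact Milne1999.sum_cross_mem_span_rational_oneOne_of_eigen φ (g j) (g j')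
    (fun i => ofRatClassBaseChange (Motives.ComplexPoints A.X) 1 (cb ((k, 0), i)))
    (fun i => ofRatClassBaseChange (Motives.ComplexPoints A.X) 1 (cb ((k, 1), i))) hneμ he hf hθ

end Assembly

/-- **MZ99 (1.8) ⟹ for `D = E` quartic CM, all powers: `B•(A^{N+1}) = D•(A^{N+1}) ⊗ ℂ`** for `A` with `End⁰(A)` of
`ℚ`-dimension `4` generated by `φ` with eigenvalue pairs of total multiplicity `n₀`, `dim A = 2n₀`, and `Hg(A) = U_E` in
the Lie form `hU`. [cite: MoonenZarhin1999LowDim, §1 (1.8) and §2 (2.3)] [cite: Milne1999LefschetzClasses, Prop. 3.6 (c)] -/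
theorem AbelianVariety.isDivisorGenerated_powSucc_of_hodgeLieC_quarticCM [HodgeTensorFacts.{0, 0}]
    (A : AbelianVariety ℂ) (φ : A ⟶ A) (hE4 : Module.finrank ℚ A.endAlgebra = 4) {μ₁ μ₂ : ℂ}
    (h11 : starRingEnd ℂ μ₁ ≠ μ₁) (h22 : starRingEnd ℂ μ₂ ≠ μ₂) (h12 : μ₂ ≠ μ₁) (h12' : μ₂ ≠ starRingEnd ℂ μ₁)
    {n₀ : ℕ} (hn₀ : 0 < n₀) (h1 : eigenMultiplicity A φ μ₁ + eigenMultiplicity A φ (starRingEnd ℂ μ₁) = n₀)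
    (h2 : eigenMultiplicity A φ μ₂ + eigenMultiplicity A φ (starRingEnd ℂ μ₂) = n₀) (hdim : A.dim = 2 * n₀)
    (hHD : exists_isReal_hodgeModel) (hI : hodgePQ_independent_of_hodgeModel)
    (ψ : (BettiUniverse.hodge hHD (AbelianVariety.isSmoothProjective_holds (A := A)) 1).Polarization)
    (hU : ∀ Y : Module.End ℂ (ℂ ⊗[ℚ] bettiCohomology A.X 1),
      Y * ((bettiCohomology.map φ.hom.hom.hom 1).hom).baseChange ℂ =
          ((bettiCohomology.map φ.hom.hom.hom 1).hom).baseChange ℂ * Y →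
        (∀ x y, ψ.form.baseChange ℂ (Y x) y + ψ.form.baseChange ℂ x (Y y) = 0) →
          Y ∈ (BettiUniverse.hodge hHD (AbelianVariety.isSmoothProjective_holds (A := A)) 1).hodgeLieC)
    (N : ℕ) : IsDivisorGenerated (A.powSucc N) :=
  (AVSlots.powSucc A N).isDivisorGenerated_of_hodgeLieC_quarticCM φ hE4 h11 h22 h12 h12' hn₀ h1 h2 hdim hHD hI ψ hU

/-- `A` itself: `B•(A) = D•(A) ⊗ ℂ` under `hU` (quartic CM centre, any multiplicities). [cite: MoonenZarhin1999LowDim, §1 (1.8)] -/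
theorem AbelianVariety.isDivisorGenerated_of_hodgeLieC_quarticCM [HodgeTensorFacts.{0, 0}]
    (A : AbelianVariety ℂ) (φ : A ⟶ A) (hE4 : Module.finrank ℚ A.endAlgebra = 4) {μ₁ μ₂ : ℂ}
    (h11 : starRingEnd ℂ μ₁ ≠ μ₁) (h22 : starRingEnd ℂ μ₂ ≠ μ₂) (h12 : μ₂ ≠ μ₁) (h12' : μ₂ ≠ starRingEnd ℂ μ₁)
    {n₀ : ℕ} (hn₀ : 0 < n₀) (h1 : eigenMultiplicity A φ μ₁ + eigenMultiplicity A φ (starRingEnd ℂ μ₁) = n₀)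
    (h2 : eigenMultiplicity A φ μ₂ + eigenMultiplicity A φ (starRingEnd ℂ μ₂) = n₀) (hdim : A.dim = 2 * n₀)
    (hHD : exists_isReal_hodgeModel) (hI : hodgePQ_independent_of_hodgeModel)
    (ψ : (BettiUniverse.hodge hHD (AbelianVariety.isSmoothProjective_holds (A := A)) 1).Polarization)
    (hU : ∀ Y : Module.End ℂ (ℂ ⊗[ℚ] bettiCohomology A.X 1),
      Y * ((bettiCohomology.map φ.hom.hom.hom 1).hom).baseChange ℂ =
          ((bettiCohomology.map φ.hom.hom.hom 1).hom).baseChange ℂ * Y →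
        (∀ x y, ψ.form.baseChange ℂ (Y x) y + ψ.form.baseChange ℂ x (Y y) = 0) →
          Y ∈ (BettiUniverse.hodge hHD (AbelianVariety.isSmoothProjective_holds (A := A)) 1).hodgeLieC) :
    IsDivisorGenerated A :=
  (avSlots_self A).isDivisorGenerated_of_hodgeLieC_quarticCM φ hE4 h11 h22 h12 h12' hn₀ h1 h2 hdim hHD hI ψ hU

/-- **The Hodge conjecture for all powers `A^{N+1}`** of an abelian variety with quartic CM centre and `Hg = U_E` (Lie form
`hU`): `B = D` above with Lefschetz `(1,1)` (the tree's `hodgeConjectureFor_of_isDivisorGenerated`; MZ99 (1.7): «the Hodge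
conjecture is “trivially” true for all `Xⁿ`»). [cite: MoonenZarhin1999LowDim, §1 (1.7)–(1.8)] [cite: vanGeemen1994HodgeAV, §2.4] -/
theorem hodgeConjectureFor_powSucc_of_hodgeLieC_quarticCM [HodgeTensorFacts.{0, 0}]
    (A : AbelianVariety ℂ) (φ : A ⟶ A) (hE4 : Module.finrank ℚ A.endAlgebra = 4) {μ₁ μ₂ : ℂ}
    (h11 : starRingEnd ℂ μ₁ ≠ μ₁) (h22 : starRingEnd ℂ μ₂ ≠ μ₂) (h12 : μ₂ ≠ μ₁) (h12' : μ₂ ≠ starRingEnd ℂ μ₁)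
    {n₀ : ℕ} (hn₀ : 0 < n₀) (h1 : eigenMultiplicity A φ μ₁ + eigenMultiplicity A φ (starRingEnd ℂ μ₁) = n₀)
    (h2 : eigenMultiplicity A φ μ₂ + eigenMultiplicity A φ (starRingEnd ℂ μ₂) = n₀) (hdim : A.dim = 2 * n₀)
    (hHD : exists_isReal_hodgeModel) (hI : hodgePQ_independent_of_hodgeModel)
    (ψ : (BettiUniverse.hodge hHD (AbelianVariety.isSmoothProjective_holds (A := A)) 1).Polarization)
    (hU : ∀ Y : Module.End ℂ (ℂ ⊗[ℚ] bettiCohomology A.X 1),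
      Y * ((bettiCohomology.map φ.hom.hom.hom 1).hom).baseChange ℂ =
          ((bettiCohomology.map φ.hom.hom.hom 1).hom).baseChange ℂ * Y →
        (∀ x y, ψ.form.baseChange ℂ (Y x) y + ψ.form.baseChange ℂ x (Y y) = 0) →
          Y ∈ (BettiUniverse.hodge hHD (AbelianVariety.isSmoothProjective_holds (A := A)) 1).hodgeLieC)
    (N : ℕ) : HodgeConjectureFor (A.powSucc N).dim (A.powSucc N).X :=
  hodgeConjectureFor_of_isDivisorGenerated _ (AbelianVariety.isDivisorGenerated_powSucc_of_hodgeLieC_quarticCM A φ hE4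
    h11 h22 h12 h12' hn₀ h1 h2 hdim hHD hI ψ hU N)

/-- **The Hodge conjecture for every complex abelian variety isogenous to a power** of an abelian variety with quartic CM
centre and `Hg = U_E` (van Geemen Lemma 3.7 = the tree's `HodgeConjectureFor.of_isIsogenous`).
[cite: vanGeemen1994HodgeAV, Lemma 3.7] [cite: MoonenZarhin1999LowDim, §1 (1.8)] -/
theorem hodgeConjectureFor_of_isIsogenous_powSucc_of_hodgeLieC_quarticCM [HodgeTensorFacts.{0, 0}]
    {A B' : AbelianVariety ℂ} (φ : A ⟶ A) (hE4 : Module.finrank ℚ A.endAlgebra = 4) {μ₁ μ₂ : ℂ}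
    (h11 : starRingEnd ℂ μ₁ ≠ μ₁) (h22 : starRingEnd ℂ μ₂ ≠ μ₂) (h12 : μ₂ ≠ μ₁) (h12' : μ₂ ≠ starRingEnd ℂ μ₁)
    {n₀ : ℕ} (hn₀ : 0 < n₀) (h1 : eigenMultiplicity A φ μ₁ + eigenMultiplicity A φ (starRingEnd ℂ μ₁) = n₀)
    (h2 : eigenMultiplicity A φ μ₂ + eigenMultiplicity A φ (starRingEnd ℂ μ₂) = n₀) (hdim : A.dim = 2 * n₀)
    (hHD : exists_isReal_hodgeModel) (hI : hodgePQ_independent_of_hodgeModel)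
    (ψ : (BettiUniverse.hodge hHD (AbelianVariety.isSmoothProjective_holds (A := A)) 1).Polarization)
    (hU : ∀ Y : Module.End ℂ (ℂ ⊗[ℚ] bettiCohomology A.X 1),
      Y * ((bettiCohomology.map φ.hom.hom.hom 1).hom).baseChange ℂ =
          ((bettiCohomology.map φ.hom.hom.hom 1).hom).baseChange ℂ * Y →
        (∀ x y, ψ.form.baseChange ℂ (Y x) y + ψ.form.baseChange ℂ x (Y y) = 0) →
          Y ∈ (BettiUniverse.hodge hHD (AbelianVariety.isSmoothProjective_holds (A := A)) 1).hodgeLieC)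
    {N : ℕ} (hB : B'.IsIsogenous (A.powSucc N)) : HodgeConjectureFor B'.dim B'.X :=
  HodgeConjectureFor.of_isIsogenous hB (hodgeConjectureFor_powSucc_of_hodgeLieC_quarticCM A φ hE4 h11 h22 h12 h12'
    hn₀ h1 h2 hdim hHD hI ψ hU N)

end Literature.AlgebraicGeometry.HodgeTheory

end
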